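import Mathlib.Geometry.Manifold.IsManifold.InteriorBoundary
import Mathlib.Geometry.Manifold.Instances.Real
import Mathlib.Geometry.Manifold.MFDeriv.Basic
import Literature.Geometry.Lorentzian.LorentzianMetric
import Literature.Geometry.Lorentzian.Causality
import Literature.Geometry.Lorentzian.Isometry
import HarnessLib

-- provenance: harness21/H21/H21/Prelude/Lorentz/ConformalInfinity.lean @ 18f4f3b (interim HEAD d8f2665); M5 mechanical rewrite
/-!
# Penrose conformal completion, null infinity, DOC and event horizon
(trunk G08 = T-LORENTZ, item C23; tier L, real structure)

For a four-dimensional spacetime `𝓢 : Spacetime 4` we record, as a *hypothesis structure*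
`ConformalCompletion 𝓢`, the data of a Penrose conformal completion: a time-oriented Lorentzian
manifold **with boundary** `(M̃, g̃, τ̃)` modelled on `𝓡∂ 4` (Euclidean half-space), a
conformal factor `Ω : M̃ → ℝ` and a smooth open embedding `φ : M → M̃` onto the manifold interior
of `M̃` such that `φ^* g̃ = Ω² g`, `Ω > 0` on `φ(M)`, and `Ω = 0`, `dΩ ≠ 0` on the boundary
`∂M̃ = 𝓘`. From it we derive the standard causal-boundary bookkeeping (notion
`conformal_null_infinity_doc_horizon`, statement id **gr.S16**):

* `ConformalCompletion.futureNullInfinity C` (`𝓘⁺ = ∂M̃ ∩ I⁺(φ(M), M̃)`),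
  `ConformalCompletion.pastNullInfinity C` (`𝓘⁻`);
* `ConformalCompletion.domainOfOuterCommunications C = φ⁻¹(J⁻(𝓘⁺) ∩ J⁺(𝓘⁻))`;
* `ConformalCompletion.blackHoleRegion C = M ∖ φ⁻¹ J⁻(𝓘⁺)`,
  `ConformalCompletion.futureEventHorizon C = ∂(blackHoleRegion C)` (**gr.S16**),
  `ConformalCompletion.whiteHoleRegion C = M ∖ φ⁻¹ J⁺(𝓘⁻)`.

Only the bare structure and the derived sets are provided (the API — regularity of `𝓘⁺`,
`H⁺ = ∂J⁻(𝓘⁺)` is a null achronal hypersurface, independence of the completion — is tier L and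
out of scope). Completeness of the null generators of `𝓘⁺` is deliberately **omitted**: the
statement files use Christodoulou's intrinsic notion (`NullInfinity.lean`), and this file is not
imported by any statement file.

## Mathlib

Manifolds with boundary are Mathlib's: `EuclideanHalfSpace 4`, the model with corners `𝓡∂ 4`
(`Mathlib.Geometry.Manifold.Instances.Real`), and `ModelWithCorners.IsInteriorPoint`,
`ModelWithCorners.IsBoundaryPoint`, `ModelWithCorners.interior`, `ModelWithCorners.boundary`
(`Mathlib.Geometry.Manifold.IsManifold.InteriorBoundary`). The manifold derivative `mfderiv` is a
`fderivWithin (range I)` in charts and is therefore meaningful at boundary points. Open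
embeddings are `Topology.IsOpenEmbedding`. Mathlib has no conformal geometry of
(pseudo-)Riemannian metrics (`rg -i 'conformal' Mathlib/Geometry/Manifold` only finds conformal
*maps* of inner product spaces / the Riemann sphere), no Penrose diagram, no null infinity.
From H21 we use `LorentzianMetric`, `TimeOrientation`, `Spacetime` (`LorentzianMetric.lean`),
`pullbackBilin` (`Isometry.lean`; the field `timeOrientation_compat` is
`TimeOrientation.PreservesTimeOrientation` unfolded, since that predicate wants equal regularity
indices while `g` is `C^∞` and `g̃` only `C²`) and
`chronologicalFuture/Past`, `causalFuture/Past` (`Causality.lean`).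

## Design choices

* `ConformalCompletion 𝓢` is a `Type (u+1)`-valued structure bundling the unphysical manifold
  `unphys : Type u` with its instances as instance-implicit fields (like `LorentzianMetric.lean`'s
  `LorentzianManifold`), registered as instances by `attribute [instance]`.
* The unphysical metric `gTilde` is only required to be `C²` (the regularity at `𝓘` available in
  general, cf. the peeling/polyhomogeneity literature; Wald 1984 §11.1 asks for `C³` of `Ω`, we ask
  `Ω` to be `C^∞` as a function on the `C^∞` manifold `M̃` — this constrains nothing physical since
  `g̃` is only `C²`).
* `range_φ` pins `φ(M)` to be exactly the manifold interior `M̃ ∖ ∂M̃`, so `∂M̃` is all of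
  "infinity" (`𝓘⁺ ∪ 𝓘⁻`, plus whatever further boundary pieces — e.g. a regular `i⁰` is *not* a
  smooth boundary point and is simply absent from `M̃`). Hawking–Ellis 1973 §6.9, Wald 1984 §11.1
  (asymptotically simple / weakly asymptotically simple spacetimes).
* `𝓘⁺ := ∂M̃ ∩ I⁺(φ(M))` and `𝓘⁻ := ∂M̃ ∩ I⁻(φ(M))` (Wald 1984, p. 282). The domain of outer
  communications is `φ⁻¹(J⁻(𝓘⁺) ∩ J⁺(𝓘⁻))` with **causal** pasts/futures computed in `M̃`
  (Hawking–Ellis §9.2 use `J⁻(𝓘⁺, M̄)`; Wald (12.1.4) uses `I⁻(𝓘⁺)`; for the open set `φ(M)` and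
  the open boundary piece `𝓘⁺` these agree under standard causality assumptions, which we do not
  need to state here). The black-hole region is `B = M ∖ φ⁻¹ J⁻(𝓘⁺)` and the future event horizon
  is its topological frontier `H⁺ = ∂B = ∂(φ⁻¹ J⁻(𝓘⁺))` in `M` (Wald (12.1.2)–(12.1.3);
  Hawking–Ellis §9.2, p. 312).
* Only trivial set-theoretic lemmas are proved (tier L); in particular we do not assert that
  `H⁺` is a null hypersurface or that the DOC is open.

## References

* R. Penrose, *Asymptotic properties of fields and space-times*, Phys. Rev. Lett. 10 (1963) 66;
  *Zero rest-mass fields including gravitation: asymptotic behaviour*, Proc. Roy. Soc. A 284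
  (1965) 159.
* R. M. Wald, *General Relativity*, Chicago 1984, §11.1 (conformal infinity, asymptotic
  simplicity), §12.1 (black holes, event horizon, eqs. (12.1.1)–(12.1.4)).
* S. W. Hawking, G. F. R. Ellis, *The large scale structure of space-time*, CUP 1973, §6.9
  (asymptotically simple spaces), §9.2 (black holes: `J⁻(𝓘⁺, M̄)`, event horizon).
* D. Christodoulou, *On the global initial value problem and the issue of singularities*, CQG 16
  (1999) A23; M. Dafermos, I. Rodnianski, *Lectures on black holes and linear waves*, Clay Math.
  Proc. 17 (2013), §2.6.2 (comparison with the intrinsic notion; gr.S16).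
-/

open Manifold Bundle TopologicalSpace Set Topology
open scoped ContDiff

noncomputable section

universe u

namespace Literature.Geometry.Lorentzian

/-! ### The conformal completion as a hypothesis structure -/

/-- A **Penrose conformal completion** of a four-dimensional spacetime `𝓢 = (M, g, τ)`
(Penrose 1963/1965; Wald 1984, §11.1; Hawking–Ellis 1973, §6.9): an *unphysical* time-oriented
Lorentzian manifold with boundary `(M̃, g̃, τ̃)` (Hausdorff, second countable, `C^∞` atlas
modelled on the half-space `𝓡∂ 4`, metric `g̃` of class `C²`), a `C^∞` conformal factor
`Ω : M̃ → ℝ` and a `C^∞` open embedding `φ : M → M̃` such that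

* `φ(M)` is exactly the manifold interior of `M̃` (so `∂M̃` is "infinity" `𝓘`);
* `φ^* g̃ = Ω² g` on `M` (conformality) and `φ` maps the time orientation of `M` into that of
  `M̃`;
* `Ω ∘ φ > 0` on `M`;
* `Ω = 0` and `dΩ ≠ 0` at every boundary point of `M̃`.

Completeness of the null generators of `𝓘⁺` and the vacuum equations near `𝓘` are **not** part
of the structure (see the module docstring). [cite: Penrose1963, /1965] -/
structure ConformalCompletion (𝓢 : Spacetime.{u} 4) : Type (u + 1) where
  /-- The unphysical (conformally completed) manifold with boundary `M̃`. -/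
  unphys : Type u
  /-- The topology of `M̃`. -/
  [topologicalSpace : TopologicalSpace unphys]
  /-- The `C^∞` atlas of `M̃`, modelled on the Euclidean half-space `{x₀ ≥ 0} ⊆ ℝ⁴`. -/
  [chartedSpace : ChartedSpace (EuclideanHalfSpace 4) unphys]
  /-- The charts of `M̃` are `C^∞`-compatible (for the model with corners `𝓡∂ 4`). -/
  [isManifold : IsManifold (𝓡∂ 4) ∞ unphys]
  /-- `M̃` is Hausdorff. -/
  [t2Space : T2Space unphys]
  /-- `M̃` is second countable. -/
  [secondCountableTopology : SecondCountableTopology unphys]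
  /-- The unphysical Lorentzian metric `g̃` on `M̃`, of class `C²` up to the boundary. -/
  gTilde : LorentzianMetric (𝓡∂ 4) 2 unphys
  /-- The time orientation `τ̃` of `g̃`. -/
  τTilde : TimeOrientation gTilde
  /-- The conformal factor `Ω : M̃ → ℝ`. -/
  Ω : unphys → ℝ
  /-- `Ω` is `C^∞` on `M̃` (up to and including the boundary). -/
  Ω_contMDiff : ContMDiff (𝓡∂ 4) 𝓘(ℝ, ℝ) ∞ Ω
  /-- The conformal embedding `φ : M → M̃` of the physical spacetime. -/
  φ : 𝓢.carrier → unphys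
  /-- `φ` is `C^∞`. -/
  φ_contMDiff : ContMDiff (𝓡 4) (𝓡∂ 4) ∞ φ
  /-- `φ` is an open topological embedding. -/
  φ_isOpenEmbedding : IsOpenEmbedding φ
  /-- The image of `φ` is exactly the manifold interior `M̃ ∖ ∂M̃` of `M̃`. -/
  range_φ : range φ = {q | (𝓡∂ 4).IsInteriorPoint q}
  /-- **Conformality**: `φ^* g̃ = (Ω ∘ φ)² g` pointwise on `M`. -/
  conformal (x : 𝓢.carrier) :
    pullbackBilin (I := 𝓡∂ 4) (I' := 𝓡 4) φ gTilde.val x = (Ω (φ x)) ^ 2 • 𝓢.metric.val x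
  /-- `φ` maps the orienting vector field of `(M, g, τ)` to future-directed vectors of
  `(M̃, g̃, τ̃)` (this is `TimeOrientation.PreservesTimeOrientation φ τ τ̃` unfolded; that
  predicate is only stated for metrics of equal regularity index, here `∞ ≠ 2`). -/
  timeOrientation_compat (x : 𝓢.carrier) :
    τTilde.IsFutureDirected (mfderiv (𝓡 4) (𝓡∂ 4) φ x (𝓢.timeOrientation.vectorField x))
  /-- The conformal factor is positive on the physical spacetime. -/
  Ω_pos (x : 𝓢.carrier) : 0 < Ω (φ x)
  /-- On the boundary `∂M̃ = 𝓘` the conformal factor vanishes to first order exactly: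
  `Ω = 0` and `dΩ ≠ 0`. -/
  Ω_bdry (q : unphys) (hq : (𝓡∂ 4).IsBoundaryPoint q) :
    Ω q = 0 ∧ mfderiv (𝓡∂ 4) 𝓘(ℝ, ℝ) Ω q ≠ 0

attribute [instance] ConformalCompletion.topologicalSpace ConformalCompletion.chartedSpace
  ConformalCompletion.isManifold ConformalCompletion.t2Space
  ConformalCompletion.secondCountableTopology

namespace ConformalCompletion

variable {𝓢 : Spacetime.{u} 4} (C : ConformalCompletion 𝓢)

/-! ### Null infinity -/

/-- **Future null infinity** `𝓘⁺ ⊆ M̃` of a conformal completion: the boundary points of `M̃`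
lying in the chronological future (in `(M̃, g̃, τ̃)`) of the physical spacetime `φ(M)`.
Wald 1984, §11.1, p. 282; Hawking–Ellis 1973, §6.9. [cite: Wald1984, §11.1  p. 282] -/
def futureNullInfinity : Set C.unphys :=
  {q | (𝓡∂ 4).IsBoundaryPoint q ∧ q ∈ C.gTilde.chronologicalFuture C.τTilde (range C.φ)}

/-- **Past null infinity** `𝓘⁻ ⊆ M̃`: the boundary points of `M̃` lying in the chronological
past (in `(M̃, g̃, τ̃)`) of `φ(M)`. Wald 1984, §11.1, p. 282; Hawking–Ellis 1973, §6.9. [cite: Wald1984, §11.1  p. 282] -/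
def pastNullInfinity : Set C.unphys :=
  {q | (𝓡∂ 4).IsBoundaryPoint q ∧ q ∈ C.gTilde.chronologicalPast C.τTilde (range C.φ)}

/-- `𝓘⁺` is contained in the boundary `∂M̃`. Wald 1984, §11.1. [cite: Wald1984, §11.1] -/
lemma futureNullInfinity_subset_boundary :
    C.futureNullInfinity ⊆ (𝓡∂ 4).boundary C.unphys := fun _ hq ↦ hq.1

/-- `𝓘⁻` is contained in the boundary `∂M̃`. Wald 1984, §11.1. [cite: Wald1984, §11.1] -/
lemma pastNullInfinity_subset_boundary :
    C.pastNullInfinity ⊆ (𝓡∂ 4).boundary C.unphys := fun _ hq ↦ hq.1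

/-- `𝓘⁺` is disjoint from the (image of the) physical spacetime `φ(M)`, which consists of
interior points. Wald 1984, §11.1. [cite: Wald1984, §11.1] -/
lemma disjoint_futureNullInfinity_range :
    Disjoint C.futureNullInfinity (range C.φ) := by
  refine Set.disjoint_left.mpr fun q hq hq' ↦ ?_
  rw [C.range_φ] at hq'
  exact ((𝓡∂ 4).isInteriorPoint_iff_not_isBoundaryPoint q).mp hq' hq.1

/-! ### Domain of outer communications, black hole, event horizon -/

/-- **gr.S16** (domain of outer communications, conformal form; Hawking–Ellis 1973 §9.2,
Wald 1984 §12.1 (12.1.4), Dafermos–Rodnianski 2013 §2.6.2). The **domain of outer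
communications** `⟪M⟫ = φ⁻¹ (J⁻(𝓘⁺) ∩ J⁺(𝓘⁻)) ⊆ M`: the events of the physical spacetime which
can both send a causal signal to future null infinity and receive one from past null infinity
(causal futures/pasts computed in the unphysical spacetime `(M̃, g̃, τ̃)`). [cite: HawkingEllis1973, §9.2  Wald 1984 §12.1 (12.1.4] -/
def domainOfOuterCommunications : Set 𝓢.carrier :=
  C.φ ⁻¹' (C.gTilde.causalPast C.τTilde C.futureNullInfinity ∩
    C.gTilde.causalFuture C.τTilde C.pastNullInfinity)

/-- **gr.S16** (black-hole region, conformal form; Wald 1984 §12.1 (12.1.2), Hawking–Ellis 1973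
§9.2 p. 312). The **black-hole region** `B = M ∖ φ⁻¹ J⁻(𝓘⁺)`: the events of `M` from which no
future-directed causal curve (in `M̃`) reaches future null infinity. [cite: Wald1984, §12.1 (12.1.2] -/
def blackHoleRegion : Set 𝓢.carrier :=
  (C.φ ⁻¹' C.gTilde.causalPast C.τTilde C.futureNullInfinity)ᶜ

/-- **gr.S16** (DOC, event horizon, black-hole region (conformal form); Wald 1984 §12.1
(12.1.3), Hawking–Ellis 1973 §9.2 p. 312, Dafermos–Rodnianski 2013 §2.6.2). The **future event
horizon** `H⁺ = ∂B = ∂(φ⁻¹ J⁻(𝓘⁺))`, the topological frontier in `M` of the black-hole region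
(equivalently of the past of future null infinity). [cite: Wald1984, §12.1 (12.1.3] -/
def futureEventHorizon : Set 𝓢.carrier :=
  frontier C.blackHoleRegion

/-- The **white-hole region** `W = M ∖ φ⁻¹ J⁺(𝓘⁻)`: the events of `M` which cannot be reached by
a future-directed causal curve from past null infinity (time dual of `blackHoleRegion`).
Wald 1984, §12.1, p. 301; Hawking–Ellis 1973, §9.2. [cite: Wald1984, §12.1  p. 301] -/
def whiteHoleRegion : Set 𝓢.carrier :=
  (C.φ ⁻¹' C.gTilde.causalFuture C.τTilde C.pastNullInfinity)ᶜ

/-- The future event horizon is the frontier of `φ⁻¹ J⁻(𝓘⁺)` (frontier of a complement).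
Wald 1984, (12.1.3). [cite: Wald1984, (12.1.3] -/
lemma futureEventHorizon_eq_frontier_preimage_causalPast :
    C.futureEventHorizon = frontier (C.φ ⁻¹' C.gTilde.causalPast C.τTilde C.futureNullInfinity) :=
  frontier_compl _

/-- The domain of outer communications is disjoint from the black-hole region.
Wald 1984, §12.1. [cite: Wald1984, §12.1] -/
lemma disjoint_domainOfOuterCommunications_blackHoleRegion :
    Disjoint C.domainOfOuterCommunications C.blackHoleRegion :=
  Set.disjoint_left.mpr fun _ hx hB ↦ hB hx.1

/-- The domain of outer communications is disjoint from the white-hole region.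
Wald 1984, §12.1. [cite: Wald1984, §12.1] -/
lemma disjoint_domainOfOuterCommunications_whiteHoleRegion :
    Disjoint C.domainOfOuterCommunications C.whiteHoleRegion :=
  Set.disjoint_left.mpr fun _ hx hW ↦ hW hx.2

/-- `M` decomposes as `⟪M⟫ ∪ B ∪ W` (an event outside both the black- and the white-hole region
communicates with both null infinities). Wald 1984, §12.1. [cite: Wald1984, §12.1] -/
lemma domainOfOuterCommunications_union_blackHoleRegion_union_whiteHoleRegion :
    C.domainOfOuterCommunications ∪ C.blackHoleRegion ∪ C.whiteHoleRegion = univ := by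
  ext x
  simp only [domainOfOuterCommunications, blackHoleRegion, whiteHoleRegion, mem_union,
    mem_preimage, mem_inter_iff, mem_compl_iff, mem_univ, iff_true]
  tauto

end ConformalCompletion

end Literature.Geometry.Lorentzian

end
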